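import Summits.ABC.ABC.Theorems.TwistAmplificationMazurKaneLawToolkitDefs
import Literature.NumberTheory.DiophantineGeometry.AbcShapeGeometrySets
import Literature.NumberTheory.Sieve.DivisorBound

-- Summit.ABC.ABC is the mandated summit-side namespace (single-conjunct summit); the lakefile sets the same option tree-wide.
set_option linter.dupNamespace false

/-!
# Tame boxes obey the box-level Mazur–Kane law (crux stmt-ABC-2757, stub `toolkitTame`)

Stub S3 of the line `fibre-toolkit-lp-wall-map` for the crux
`Summit.ABC.ABC.Theses.TwistAmplification.MazurKaneLaw`: with the determinant tool `DetTool` as a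
hypothesis, every shape box admissible for `(s, ε′)` that carries a toolkit certificate at the law
`θ = s − 1 + η/2` (`Toolkit.Tame`, i.e. `Toolkit.Certified (2C₀) θ`) satisfies
`B_M ≤ K · C₀^{s−1+η}` (`Toolkit.BoxLawOn Toolkit.Tame s`). No linear programme is solved here: the
certificate is the hypothesis, and the work is the exponent dictionary plus the endgame constants.

* `det_linear` — the fourth dictionary entry (next to `AbcShapes.trivial_linear`,
  `AbcShapes.geometry_disjunction`, `AbcShapes.fourier_linear`): the multiplicative determinant bound
  `B ≤ #fibres · Dτ^{3(i+2)} · 24(i+1)(i+2) · P` (for all `P ≥ P₀` with `48XᵢYᵢZᵢ ≤ A₀B₀C₀P³`) read at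
  `P = max(P₀, (48XᵢYᵢZᵢ/(A₀B₀C₀))^{1/3})` gives, with `D = log_Λ B`, `L = Σ (αᵢ+βᵢ+γᵢ)`,
  `pᵢ = αᵢ+βᵢ+γᵢ` and `log_Λ(A₀B₀C₀) = 3 − e − (i+1)pᵢ` (`e` the deficiency),
  `D ≤ L − pᵢ + … + log_Λ P₀` or `D ≤ L − 1 + ((i−1)pᵢ + e)/3 + … + log_Λ 48 / 3`;
* `shapeCount_le_of_certified` — one certificate at a time: under the standing hypotheses of the
  dictionary, `Certified Λ θ ⟹ B ≤ Λ^θ · Dτ^{3M+3} · (2^{2M²+8} V₂ · 27 · 48 · 24(M+1)(M+2)) · P₀`;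
* `toolkitTame` — the endgame of `AbcShapes.shapeCount_le_of_admissible_lt_one`: `T = V₂ · 2C₀`,
  `Dτ = ⌊C_τ T^κ⌋` (divisor bound), `P₀ = max(1, N₀, 2 log((M+2)T³)) ≪ Λ^{η/4}`
  (`log x ≤ x^κ/κ`), `κ (3M+3) = η/4`, so `B ≤ K C₀^{s−1+η}`.
-/

noncomputable section

open Finset
open Literature.NumberTheory.DiophantineGeometry
open Literature.NumberTheory.DiophantineGeometry.AbcShapes

namespace Summit.ABC.ABC.Theorems.MazurKaneLaw

open Summit.ABC.ABC.Theorems.MazurKaneLaw.Toolkit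

/-- **The determinant tool in exponent form** (fourth entry of the BBLT §6 dictionary). If for every
`P ≥ P₀` with `48 XᵢYᵢZᵢ ≤ A₀B₀C₀ P³` one has `B ≤ #fibres · Dτ^{3(i+2)} · 24(i+1)(i+2) · P`
(`A₀ = c₁ offVal_{i} X` etc., `#fibres = #subBox{i}X · #subBox{i}Y · #subBox{i}Z`), then with
`D = log_Λ B`, `L = radExp`, `pᵢ = αᵢ + βᵢ + γᵢ`, `e = deficiency`: either
`D ≤ L − pᵢ + 3(i+2) log_Λ Dτ + log_Λ(24(i+1)(i+2)) + log_Λ P₀` or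
`D ≤ L − 1 + ((i−1)pᵢ + e)/3 + 3(i+2) log_Λ Dτ + log_Λ(24(i+1)(i+2)) + log_Λ 48 / 3`
(take `P = max(P₀, (48XᵢYᵢZᵢ/(A₀B₀C₀))^{1/3})` and use `log_Λ(A₀B₀C₀) = 3 − e − (i+1)pᵢ`, which is
`cⱼ · shapeVal = (cⱼ · offVal_{i}) · (corner)ᵢ^{i+1}`). [folklore] -/
theorem det_linear {d : ℕ} {c₁ c₂ c₃ : ℕ} (hc₁ : 0 < c₁) (hc₂ : 0 < c₂) (hc₃ : 0 < c₃)
    {X Y Z : Fin d → ℕ} (hX : ∀ i, 0 < X i) (hY : ∀ i, 0 < Y i) (hZ : ∀ i, 0 < Z i) {Dτ : ℕ}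
    (hDτ : 1 ≤ Dτ) {Λ : ℝ} (hΛ : 1 < Λ) (hB : 0 < shapeCount c₁ c₂ c₃ X Y Z) (i : Fin d) {P₀ : ℝ}
    (hdet : ∀ P : ℝ, P₀ ≤ P →
      48 * ((X i : ℝ) * Y i * Z i) ≤
        ((c₁ * offVal ({i} : Finset (Fin d)) X : ℕ) : ℝ) * ((c₂ * offVal ({i} : Finset (Fin d)) Y : ℕ) : ℝ) *
          ((c₃ * offVal ({i} : Finset (Fin d)) Z : ℕ) : ℝ) * P ^ 3 →
      (shapeCount c₁ c₂ c₃ X Y Z : ℝ) ≤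
        ((subBox ({i} : Finset (Fin d)) X).card * (subBox ({i} : Finset (Fin d)) Y).card *
            (subBox ({i} : Finset (Fin d)) Z).card : ℕ) *
          (Dτ : ℝ) ^ (3 * ((i : ℕ) + 2)) * (24 * ((((i : ℕ) : ℝ) + 1) * (((i : ℕ) : ℝ) + 2))) * P) :
    Real.logb Λ (shapeCount c₁ c₂ c₃ X Y Z) ≤
        radExp Λ X Y Z - (expo Λ X i + expo Λ Y i + expo Λ Z i) +
          ((3 * ((i : ℕ) : ℝ) + 6) * Real.logb Λ Dτ +
            Real.logb Λ (24 * ((((i : ℕ) : ℝ) + 1) * (((i : ℕ) : ℝ) + 2))) + Real.logb Λ P₀) ∨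
      Real.logb Λ (shapeCount c₁ c₂ c₃ X Y Z) ≤
        radExp Λ X Y Z - 1 +
            ((((i : ℕ) : ℝ) - 1) * (expo Λ X i + expo Λ Y i + expo Λ Z i) + deficiency Λ c₁ c₂ c₃ X Y Z) / 3 +
          ((3 * ((i : ℕ) : ℝ) + 6) * Real.logb Λ Dτ +
            Real.logb Λ (24 * ((((i : ℕ) : ℝ) + 1) * (((i : ℕ) : ℝ) + 2))) + Real.logb Λ 48 / 3) := by
  classical
  have hoff : ∀ {W : Fin d → ℕ}, (∀ j, 0 < W j) → 0 < offVal ({i} : Finset (Fin d)) W := fun hW =>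
    prod_pos fun j _ => pow_pos (hW j) _
  have hon : ∀ {W : Fin d → ℕ}, (∀ j, 0 < W j) → 0 < onVal ({i} : Finset (Fin d)) W := fun hW =>
    prod_pos fun j _ => pow_pos (hW j) _
  -- name the corner cofactors `A₀, B₀, E₀` and the number of fibres `F`
  obtain ⟨A₀, hA₀⟩ : ∃ A : ℕ, A = c₁ * offVal ({i} : Finset (Fin d)) X := ⟨_, rfl⟩
  obtain ⟨B₀, hB₀⟩ : ∃ A : ℕ, A = c₂ * offVal ({i} : Finset (Fin d)) Y := ⟨_, rfl⟩
  obtain ⟨E₀, hE₀⟩ : ∃ A : ℕ, A = c₃ * offVal ({i} : Finset (Fin d)) Z := ⟨_, rfl⟩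
  obtain ⟨F, hF⟩ : ∃ F : ℕ, F = (subBox ({i} : Finset (Fin d)) X).card *
      (subBox ({i} : Finset (Fin d)) Y).card * (subBox ({i} : Finset (Fin d)) Z).card := ⟨_, rfl⟩
  rw [← hA₀, ← hB₀, ← hE₀, ← hF] at hdet
  have hA₀0 : 0 < A₀ := by rw [hA₀]; exact Nat.mul_pos hc₁ (hoff hX)
  have hB₀0 : 0 < B₀ := by rw [hB₀]; exact Nat.mul_pos hc₂ (hoff hY)
  have hE₀0 : 0 < E₀ := by rw [hE₀]; exact Nat.mul_pos hc₃ (hoff hZ)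
  have hFc : ∀ {W : Fin d → ℕ}, (∀ j, 0 < W j) → 0 < (subBox ({i} : Finset (Fin d)) W).card :=
    fun hW => by rw [card_subBox]; exact prod_pos fun j _ => hW j
  have hF0 : 0 < F := by rw [hF]; exact Nat.mul_pos (Nat.mul_pos (hFc hX) (hFc hY)) (hFc hZ)
  have hA' : (0 : ℝ) < A₀ := by exact_mod_cast hA₀0
  have hB' : (0 : ℝ) < B₀ := by exact_mod_cast hB₀0
  have hE' : (0 : ℝ) < E₀ := by exact_mod_cast hE₀0
  have hF' : (0 : ℝ) < F := by exact_mod_cast hF0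
  have hXi : (0 : ℝ) < X i := by exact_mod_cast hX i
  have hYi : (0 : ℝ) < Y i := by exact_mod_cast hY i
  have hZi : (0 : ℝ) < Z i := by exact_mod_cast hZ i
  have hDτ' : (0 : ℝ) < Dτ := by exact_mod_cast hDτ
  have h24 : (0 : ℝ) < 24 * ((((i : ℕ) : ℝ) + 1) * (((i : ℕ) : ℝ) + 2)) := by positivity
  have hBr : (0 : ℝ) < shapeCount c₁ c₂ c₃ X Y Z := by exact_mod_cast hB
  -- the cube root `Q` of `R = 48XᵢYᵢZᵢ/(A₀B₀E₀)` and the choice `P = max P₀ Q`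
  obtain ⟨R, hR⟩ : ∃ R : ℝ, R = 48 * ((X i : ℝ) * Y i * Z i) / ((A₀ : ℝ) * B₀ * E₀) := ⟨_, rfl⟩
  have hR0 : 0 < R := by rw [hR]; positivity
  obtain ⟨Q, hQ⟩ : ∃ Q : ℝ, Q = R ^ ((1 : ℝ) / 3) := ⟨_, rfl⟩
  have hQ0 : 0 < Q := by rw [hQ]; exact Real.rpow_pos_of_pos hR0 _
  have hQ3 : Q ^ 3 = R := by rw [hQ, ← Real.rpow_natCast, ← Real.rpow_mul hR0.le]; norm_num
  obtain ⟨P, hP⟩ : ∃ P : ℝ, P = max P₀ Q := ⟨_, rfl⟩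
  have hP₀P : P₀ ≤ P := by rw [hP]; exact le_max_left _ _
  have hQP : Q ≤ P := by rw [hP]; exact le_max_right _ _
  have hP0 : 0 < P := lt_of_lt_of_le hQ0 hQP
  have h48 : 48 * ((X i : ℝ) * Y i * Z i) ≤ (A₀ : ℝ) * B₀ * E₀ * P ^ 3 := by
    have e : 48 * ((X i : ℝ) * Y i * Z i) = (A₀ : ℝ) * B₀ * E₀ * Q ^ 3 := by
      rw [hQ3, hR]; field_simp
    exact e ▸ mul_le_mul_of_nonneg_left (pow_le_pow_left₀ hQ0.le hQP 3) (by positivity)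
  have hbd := hdet P hP₀P h48
  -- `log_Λ #fibres = L - pᵢ`
  have hlogF : Real.logb Λ (F : ℝ) = radExp Λ X Y Z - (expo Λ X i + expo Λ Y i + expo Λ Z i) := by
    rw [hF, logb_natMul (Nat.mul_pos (hFc hX) (hFc hY)) (hFc hZ), logb_natMul (hFc hX) (hFc hY),
      logb_card_subBox _ hX, logb_card_subBox _ hY, logb_card_subBox _ hZ, radExp, sum_add_distrib,
      sum_add_distrib, sum_singleton, sum_singleton, sum_singleton]
    ring
  -- the multiplicative bound in logarithmic form
  have hmain : Real.logb Λ (shapeCount c₁ c₂ c₃ X Y Z) ≤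
      radExp Λ X Y Z - (expo Λ X i + expo Λ Y i + expo Λ Z i) +
        (3 * ((i : ℕ) : ℝ) + 6) * Real.logb Λ Dτ +
        Real.logb Λ (24 * ((((i : ℕ) : ℝ) + 1) * (((i : ℕ) : ℝ) + 2))) + Real.logb Λ P := by
    have hx1 : (0 : ℝ) < (F : ℝ) * (Dτ : ℝ) ^ (3 * ((i : ℕ) + 2)) := mul_pos hF' (pow_pos hDτ' _)
    have hx2 : (0 : ℝ) < (F : ℝ) * (Dτ : ℝ) ^ (3 * ((i : ℕ) + 2)) *
        (24 * ((((i : ℕ) : ℝ) + 1) * (((i : ℕ) : ℝ) + 2))) := mul_pos hx1 h24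
    have h1 := Real.logb_le_logb_of_le hΛ hBr hbd
    rw [Real.logb_mul hx2.ne' hP0.ne', Real.logb_mul hx1.ne' h24.ne',
      Real.logb_mul hF'.ne' (pow_pos hDτ' _).ne', hlogF, Real.logb_pow] at h1
    push_cast at h1
    linarith
  rcases le_total Q P₀ with hQP₀ | hP₀Q
  · -- `P = P₀`
    left
    rw [show P = P₀ by rw [hP]; exact max_eq_left hQP₀] at hmain
    linarith
  · -- `P = Q`, `log_Λ Q = (log_Λ 48 + pᵢ - log_Λ (A₀B₀E₀)) / 3`
    right
    have hPQ : P = Q := by rw [hP]; exact max_eq_right hP₀Q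
    have hlogQ : Real.logb Λ Q = (Real.logb Λ 48 + (expo Λ X i + expo Λ Y i + expo Λ Z i) -
        (Real.logb Λ A₀ + Real.logb Λ B₀ + Real.logb Λ E₀)) / 3 := by
      rw [hQ, Real.logb_rpow_eq_mul_logb_of_pos hR0, hR, Real.logb_div (by positivity) (by positivity),
        Real.logb_mul (by norm_num) (by positivity), Real.logb_mul (by positivity) hZi.ne',
        Real.logb_mul hXi.ne' hYi.ne', Real.logb_mul (by positivity) hE'.ne',
        Real.logb_mul hA'.ne' hB'.ne']
      simp only [expo]; ring
    -- `log_Λ (cⱼ · shapeVal) = log_Λ (cⱼ · offVal_{i}) + (i+1) · exponentᵢ`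
    have hsplit : ∀ {c : ℕ} {W : Fin d → ℕ}, 0 < c → (∀ j, 0 < W j) →
        Real.logb Λ ((c * shapeVal W : ℕ) : ℝ) =
          Real.logb Λ ((c * offVal ({i} : Finset (Fin d)) W : ℕ) : ℝ) + (((i : ℕ) : ℝ) + 1) * expo Λ W i := by
      intro c W hc hW
      rw [shapeVal_eq_offVal_mul_onVal {i} W, ← mul_assoc, logb_natMul (Nat.mul_pos hc (hoff hW)) (hon hW),
        logb_onVal _ hW, sum_singleton]
    have hdef : deficiency Λ c₁ c₂ c₃ X Y Z = 3 - ((Real.logb Λ A₀ + (((i : ℕ) : ℝ) + 1) * expo Λ X i) +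
        (Real.logb Λ B₀ + (((i : ℕ) : ℝ) + 1) * expo Λ Y i) +
        (Real.logb Λ E₀ + (((i : ℕ) : ℝ) + 1) * expo Λ Z i)) := by
      rw [deficiency, hsplit hc₁ hX, hsplit hc₂ hY, hsplit hc₃ hZ, ← hA₀, ← hB₀, ← hE₀]
    rw [hPQ, hlogQ] at hmain
    rw [hdef]; linarith

/-- **One certificate at a time**: under the standing hypotheses of the dictionary (positivity,
`cⱼ · shapeVal(2·) ≤ T`, `τ(m) ≤ Dτ` for `1 ≤ m ≤ T`, `Λ = 2C₀ > 1`, `C₀ ≤ V₂ c₃ ∏ Zᵢ^{i+1}`, `B > 0`) and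
the determinant tool at every coordinate `i ≥ 1` for all `P ≥ P₀ ≥ 1`, a toolkit certificate
`Certified Λ θ` gives `B ≤ Λ^θ · Dτ^{3d+3} · (2^{2d²+8} · V₂ · 27 · 48 · 24(d+1)(d+2)) · P₀`
(`V₂ = ∏ 2^{i+1}`): each of the four tools' exponent forms (`trivial_linear`, `geometry_disjunction`,
`fourier_linear`, `det_linear`) bounds `log_Λ B` by `θ` plus its loss, and the losses are collected
crudely (`Σ_I (i+1) ≤ d²`, `3(i+2) ≤ 3d+3`). [folklore] -/
theorem shapeCount_le_of_certified {d : ℕ} {c₁ c₂ c₃ : ℕ} (hc₁ : 0 < c₁) (hc₂ : 0 < c₂)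
    (hc₃ : 0 < c₃) {X Y Z : Fin d → ℕ} (hX : ∀ i, 0 < X i) (hY : ∀ i, 0 < Y i) (hZ : ∀ i, 0 < Z i)
    {T Dτ : ℕ} (hTX : c₁ * shapeVal (fun i => 2 * X i) ≤ T) (hTY : c₂ * shapeVal (fun i => 2 * Y i) ≤ T)
    (hTZ : c₃ * shapeVal (fun i => 2 * Z i) ≤ T) (hD : ∀ m : ℕ, m ≠ 0 → m ≤ T → m.divisors.card ≤ Dτ)
    {Λ : ℝ} (hΛ : 1 < Λ) (hB : 0 < shapeCount c₁ c₂ c₃ X Y Z) {C₀ : ℕ} (hC₀ : 1 ≤ C₀)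
    (hΛC : Λ = 2 * C₀) (hC₀le : C₀ ≤ shapeVal (fun _ : Fin d => 2) * (c₃ * shapeVal Z)) {P₀ : ℝ}
    (hP₀ : 1 ≤ P₀)
    (hdet : ∀ i : Fin d, 1 ≤ (i : ℕ) → ∀ P : ℝ, P₀ ≤ P →
      48 * ((X i : ℝ) * Y i * Z i) ≤
        ((c₁ * offVal ({i} : Finset (Fin d)) X : ℕ) : ℝ) * ((c₂ * offVal ({i} : Finset (Fin d)) Y : ℕ) : ℝ) *
          ((c₃ * offVal ({i} : Finset (Fin d)) Z : ℕ) : ℝ) * P ^ 3 →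
      (shapeCount c₁ c₂ c₃ X Y Z : ℝ) ≤
        ((subBox ({i} : Finset (Fin d)) X).card * (subBox ({i} : Finset (Fin d)) Y).card *
            (subBox ({i} : Finset (Fin d)) Z).card : ℕ) *
          (Dτ : ℝ) ^ (3 * ((i : ℕ) + 2)) * (24 * ((((i : ℕ) : ℝ) + 1) * (((i : ℕ) : ℝ) + 2))) * P)
    {θ : ℝ} (hcert : Certified Λ θ c₁ c₂ c₃ X Y Z) :
    (shapeCount c₁ c₂ c₃ X Y Z : ℝ) ≤
      Λ ^ θ * (Dτ : ℝ) ^ (3 * (d : ℝ) + 3) *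
        ((2 : ℝ) ^ (2 * (d : ℝ) * d + 8) * ((shapeVal (fun _ : Fin d => 2) : ℕ) : ℝ) * 27 * 48 *
          (24 * (((d : ℝ) + 1) * ((d : ℝ) + 2)))) * P₀ := by
  classical
  have hDτ1 : 1 ≤ Dτ := by
    have h1 : (1 : ℕ) ≤ T := le_trans (Nat.mul_pos hc₃ (shapeVal_pos fun i => Nat.mul_pos two_pos (hZ i))) hTZ
    simpa using hD 1 one_ne_zero h1
  have hΛ0 : 0 < Λ := by linarith
  set V₂ : ℕ := shapeVal (fun _ : Fin d => 2) with hV₂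
  have hV₂0 : 0 < V₂ := shapeVal_pos fun _ => two_pos
  have hV₂r : (0 : ℝ) < V₂ := by exact_mod_cast hV₂0
  have hDτr : (0 : ℝ) < Dτ := by exact_mod_cast hDτ1
  have hd0 : (0 : ℝ) ≤ d := Nat.cast_nonneg _
  have h24 : (1 : ℝ) ≤ 24 * (((d : ℝ) + 1) * ((d : ℝ) + 2)) := by nlinarith
  have hlD : 0 ≤ Real.logb Λ Dτ := Real.logb_nonneg hΛ (by exact_mod_cast hDτ1)
  have hl2 : 0 ≤ Real.logb Λ 2 := Real.logb_nonneg hΛ (by norm_num)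
  have hlV : 0 ≤ Real.logb Λ V₂ := Real.logb_nonneg hΛ (by exact_mod_cast hV₂0)
  have hl27 : 0 ≤ Real.logb Λ 27 := Real.logb_nonneg hΛ (by norm_num)
  have hl48 : 0 ≤ Real.logb Λ 48 := Real.logb_nonneg hΛ (by norm_num)
  have hl24 : 0 ≤ Real.logb Λ (24 * (((d : ℝ) + 1) * ((d : ℝ) + 2))) := Real.logb_nonneg hΛ h24
  have hlP : 0 ≤ Real.logb Λ P₀ := Real.logb_nonneg hΛ hP₀
  have hdlD : 0 ≤ (d : ℝ) * Real.logb Λ Dτ := mul_nonneg hd0 hlD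
  have hddl2 : 0 ≤ (2 * (d : ℝ) * d + 8) * Real.logb Λ 2 := by positivity
  have hP₀0 : 0 < P₀ := by linarith
  have hL : radExp Λ X Y Z = ∑ i, expo Λ X i + ∑ i, expo Λ Y i + ∑ i, expo Λ Z i := by
    rw [radExp, sum_add_distrib, sum_add_distrib]
  -- the additive form `log_Λ B ≤ θ + losses`
  have hadd : Real.logb Λ (shapeCount c₁ c₂ c₃ X Y Z) ≤
      θ + ((3 * (d : ℝ) + 3) * Real.logb Λ Dτ + (2 * (d : ℝ) * d + 8) * Real.logb Λ 2 + Real.logb Λ V₂ +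
        Real.logb Λ 27 + Real.logb Λ 48 + Real.logb Λ (24 * (((d : ℝ) + 1) * ((d : ℝ) + 2))) +
        Real.logb Λ P₀) := by
    rcases hcert with hT | ⟨I, J, K, h1, h2⟩ |
        ⟨SU, SV, SW, eU, eV, eW, heU, heV, heW, hSU, hSV, hSW, hF⟩ | ⟨i, hi, h1, h2⟩
    · -- trivial tool
      obtain ⟨t1, t2, t3⟩ := trivial_linear hc₁ hc₂ hc₃ hX hY hZ hTX hTY hTZ hD hΛ hB
      rcases hT with h | h | h <;> linarith
    · -- subset geometry of numbers
      have hI : ∀ I : Finset (Fin d), ∑ i ∈ I, ((i : ℕ) + 1 : ℝ) ≤ (d : ℝ) * d := fun I =>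
        calc ∑ i ∈ I, ((i : ℕ) + 1 : ℝ) ≤ ∑ _i ∈ I, (d : ℝ) :=
              sum_le_sum fun i _ => by exact_mod_cast Nat.succ_le_of_lt i.isLt
          _ ≤ ∑ _i : Fin d, (d : ℝ) :=
              sum_le_sum_of_subset_of_nonneg (subset_univ I) fun _ _ _ => hd0
          _ = d * d := by rw [sum_const, card_univ, Fintype.card_fin, nsmul_eq_mul]
      have hg := geometry_disjunction hc₁ hc₂ hc₃ hX hY hZ hTX hTY hTZ hD hΛ hB hC₀ hΛC hC₀le I J K
        le_rfl
      have hs : (8 + ∑ i ∈ I, ((i : ℕ) + 1 : ℝ) + ∑ i ∈ J, ((i : ℕ) + 1 : ℝ)) * Real.logb Λ 2 ≤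
          (2 * (d : ℝ) * d + 8) * Real.logb Λ 2 :=
        mul_le_mul_of_nonneg_right (by linarith [hI I, hI J]) hl2
      rcases hg with hg | hg <;> linarith
    · -- Fourier with saved sets
      have hf := fourier_linear hc₁ hc₂ hc₃ hX hY hZ hTX hTY hTZ hD hΛ hB SU SV SW heU heV heW hSU
        hSV hSW
      linarith
    · -- determinant method at coordinate `i`
      have hd := det_linear hc₁ hc₂ hc₃ hX hY hZ hDτ1 hΛ hB i (hdet i hi)
      have hid : ((i : ℕ) : ℝ) + 1 ≤ d := by exact_mod_cast Nat.succ_le_of_lt i.isLt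
      have hi0 : (0 : ℝ) ≤ ((i : ℕ) : ℝ) := Nat.cast_nonneg _
      have h24le : Real.logb Λ (24 * ((((i : ℕ) : ℝ) + 1) * (((i : ℕ) : ℝ) + 2))) ≤
          Real.logb Λ (24 * (((d : ℝ) + 1) * ((d : ℝ) + 2))) :=
        Real.logb_le_logb_of_le hΛ (by positivity) (by nlinarith)
      have hilD : (3 * ((i : ℕ) : ℝ) + 6) * Real.logb Λ Dτ ≤ (3 * (d : ℝ) + 3) * Real.logb Λ Dτ :=
        mul_le_mul_of_nonneg_right (by linarith) hlD
      rcases hd with hd | hd <;> linarith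
  -- exponentiate
  have hBr : (0 : ℝ) < shapeCount c₁ c₂ c₃ X Y Z := by exact_mod_cast hB
  have hpowlog : ∀ {x : ℝ} (c : ℝ), 0 < x → Λ ^ (c * Real.logb Λ x) = x ^ c := fun c hx => by
    rw [mul_comm, Real.rpow_mul hΛ0.le, Real.rpow_logb hΛ0 hΛ.ne' hx]
  have hpl : ∀ {x : ℝ}, 0 < x → Λ ^ Real.logb Λ x = x := fun hx => Real.rpow_logb hΛ0 hΛ.ne' hx
  calc (shapeCount c₁ c₂ c₃ X Y Z : ℝ) = Λ ^ Real.logb Λ (shapeCount c₁ c₂ c₃ X Y Z) :=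
        (Real.rpow_logb hΛ0 hΛ.ne' hBr).symm
    _ ≤ _ := Real.rpow_le_rpow_of_exponent_le hΛ.le hadd
    _ = _ := by
        simp only [Real.rpow_add hΛ0]
        rw [hpowlog _ hDτr, hpowlog _ two_pos, hpl hV₂r, hpl (by norm_num : (0 : ℝ) < 27),
          hpl (by norm_num : (0 : ℝ) < 48), hpl (by positivity), hpl hP₀0]
        ring

/-- **Stub S3 (`toolkitTame`): with the determinant tool, TAME boxes obey the box-level Mazur–Kane law at
every `s ∈ (1, 2)`.** For `η > 0` (any `ε₀`, here `1/4`) and `ε′`, `M = numShapes ε′`, put `T = V₂ · 2C₀`,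
`Dτ = ⌊C_τ T^κ⌋` with `κ(3M+3) = η/4` (divisor bound), `P₀ = max(1, N₀, 2 log((M+2)T³)) ≤ P_c Λ^{η/4}`
(`log x ≤ x^{η/12}/(η/12)`); then `shapeCount_le_of_certified` at `θ = s − 1 + η/2`, `Λ = 2C₀`, gives
`B ≤ Λ^θ Dτ^{3M+3} E P₀ ≤ K C₀^{s−1+η}` with `K = 2^{s−1+η} C_τ^{3M+3} V₂^{η/4} E P_c`. [folklore] -/
theorem toolkitTame : Summit.ABC.ABC.Theorems.MazurKaneLaw.Toolkit.DetTool → ∀ s : ℝ, 1 < s → s < 2 → Summit.ABC.ABC.Theorems.MazurKaneLaw.Toolkit.BoxLawOn Summit.ABC.ABC.Theorems.MazurKaneLaw.Toolkit.Tame s := by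
  rintro ⟨N₀, hN₀, hdet⟩ s _ _ η hη
  refine ⟨1 / 4, by norm_num, fun ε' _ _ => ?_⟩
  -- work in a general dimension `M` (instantiated at `numShapes ε'`)
  suffices h : ∀ M : ℕ, ∃ K : ℝ, 0 ≤ K ∧ ∀ (C₀ c₁ c₂ c₃ : ℕ) (X Y Z : Fin M → ℕ),
      Admissible s ε' C₀ c₁ c₂ c₃ X Y Z → Tame M s (η / 2) C₀ c₁ c₂ c₃ X Y Z →
        (shapeCount c₁ c₂ c₃ X Y Z : ℝ) ≤ K * (C₀ : ℝ) ^ (s - 1 + η) from h _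
  intro M
  classical
  -- the constants `V₂`, `a = 3M + 3`, `κ = η / (4a)`, `C_τ`, `κ₂ = η / 12`, `P_c`, `E`, `K`
  obtain ⟨V2, hV2⟩ : ∃ V : ℕ, V = shapeVal (fun _ : Fin M => 2) := ⟨_, rfl⟩
  have hV2pos : 0 < V2 := by rw [hV2]; exact shapeVal_pos fun _ => two_pos
  have hV2r : (0 : ℝ) < V2 := by exact_mod_cast hV2pos
  obtain ⟨a, ha⟩ : ∃ a : ℝ, a = 3 * (M : ℝ) + 3 := ⟨_, rfl⟩
  have ha0 : 0 < a := by rw [ha]; positivity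
  obtain ⟨κ, hκ⟩ : ∃ κ : ℝ, κ = η / 4 / a := ⟨_, rfl⟩
  have hκ0 : 0 < κ := by rw [hκ]; positivity
  have hκa : κ * a = η / 4 := by rw [hκ]; field_simp
  obtain ⟨Cτ, hCτ1, hCτ⟩ := Literature.NumberTheory.Sieve.exists_card_divisors_le_mul_rpow hκ0
  have hCτ0 : 0 < Cτ := by linarith
  obtain ⟨κ₂, hκ₂⟩ : ∃ κ₂ : ℝ, κ₂ = η / 12 := ⟨_, rfl⟩
  have hκ₂0 : 0 < κ₂ := by rw [hκ₂]; positivity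
  obtain ⟨G, hG⟩ : ∃ G : ℝ, G = ((M : ℝ) + 2) * (V2 : ℝ) ^ 3 := ⟨_, rfl⟩
  have hG0 : 0 < G := by rw [hG]; positivity
  obtain ⟨Pc, hPc⟩ : ∃ Pc : ℝ, Pc = 1 + N₀ + 2 * (G ^ κ₂ / κ₂) := ⟨_, rfl⟩
  have hPc1 : 1 + N₀ ≤ Pc := by rw [hPc]; linarith [show 0 ≤ 2 * (G ^ κ₂ / κ₂) by positivity]
  have hPc0 : 0 < Pc := by linarith
  obtain ⟨E, hE⟩ : ∃ E : ℝ, E = (2 : ℝ) ^ (2 * (M : ℝ) * M + 8) * (V2 : ℝ) * 27 * 48 *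
      (24 * (((M : ℝ) + 1) * ((M : ℝ) + 2))) := ⟨_, rfl⟩
  have hE0 : 0 < E := by rw [hE]; positivity
  obtain ⟨K, hK⟩ : ∃ K : ℝ, K = (2 : ℝ) ^ (s - 1 + η) * (Cτ ^ a * (V2 : ℝ) ^ (η / 4) * E * Pc) := ⟨_, rfl⟩
  have hK0 : 0 ≤ K := by rw [hK]; positivity
  refine ⟨K, hK0, fun C₀ c₁ c₂ c₃ X Y Z hA hTame => ?_⟩
  obtain ⟨hC₀1, hc₁, hc₂, hc₃, -, -, -, hXp, hYp, hZp, -, hvX, hvY, hvZ, hC₀le⟩ := hA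
  have hC₀ : (1 : ℝ) ≤ C₀ := by exact_mod_cast hC₀1
  rcases Nat.eq_zero_or_pos (shapeCount c₁ c₂ c₃ X Y Z) with hB0 | hBpos
  · rw [hB0, Nat.cast_zero]; positivity
  -- `Λ = 2C₀`, `T = V₂ · 2C₀`, `Dτ = ⌊C_τ T^κ⌋`
  obtain ⟨Λ, hΛdef⟩ : ∃ Λ : ℝ, Λ = 2 * C₀ := ⟨_, rfl⟩
  have hΛ : 1 < Λ := by rw [hΛdef]; linarith
  have hΛ0 : 0 < Λ := by linarith
  have hcert : Certified Λ (s - 1 + η / 2) c₁ c₂ c₃ X Y Z := by rw [hΛdef]; exact hTame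
  obtain ⟨T, hT⟩ : ∃ T : ℕ, T = V2 * (2 * C₀) := ⟨_, rfl⟩
  have hT1 : 1 ≤ T := by rw [hT]; exact Nat.mul_pos hV2pos (by omega)
  have hT' : (T : ℝ) = V2 * Λ := by rw [hT, hΛdef]; push_cast; ring
  have hTval : ∀ {c : ℕ} {W : Fin M → ℕ}, c * shapeVal W ≤ 2 * C₀ →
      c * shapeVal (fun i => 2 * W i) ≤ T := by
    intro c W hW
    calc c * shapeVal (fun i => 2 * W i) = V2 * (c * shapeVal W) := by
          rw [show (fun i => 2 * W i) = fun i => (fun _ : Fin M => 2) i * W i from rfl,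
            shapeVal_mul, ← hV2]; ring
      _ ≤ V2 * (2 * C₀) := Nat.mul_le_mul_left _ hW
      _ = T := hT.symm
  obtain ⟨Dτ, hDτ⟩ : ∃ D : ℕ, D = ⌊Cτ * (T : ℝ) ^ κ⌋₊ := ⟨_, rfl⟩
  have hD : ∀ n : ℕ, n ≠ 0 → n ≤ T → n.divisors.card ≤ Dτ := by
    intro n hn hnT
    rw [hDτ]
    refine Nat.le_floor ((hCτ n hn).trans ?_)
    exact mul_le_mul_of_nonneg_left (Real.rpow_le_rpow (Nat.cast_nonneg _)
      (by exact_mod_cast hnT) hκ0.le) hCτ0.le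
  have hDreal : (Dτ : ℝ) ≤ Cτ * (T : ℝ) ^ κ := by rw [hDτ]; exact Nat.floor_le (by positivity)
  -- `P₀ = max(1, N₀, 2 log((M+2) T³)) ≤ P_c Λ^{η/4}`
  obtain ⟨P₀, hP₀⟩ : ∃ P₀ : ℝ, P₀ = max 1 (max N₀ (2 * Real.log (((M : ℝ) + 2) * (T : ℝ) ^ 3))) := ⟨_, rfl⟩
  have hP₀1 : 1 ≤ P₀ := by rw [hP₀]; exact le_max_left _ _
  have hN₀P₀ : N₀ ≤ P₀ := by rw [hP₀]; exact (le_max_left _ _).trans (le_max_right _ _)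
  have hlogP₀ : 2 * Real.log (((M : ℝ) + 2) * (T : ℝ) ^ 3) ≤ P₀ := by
    rw [hP₀]; exact (le_max_right _ _).trans (le_max_right _ _)
  have hΛη : 1 ≤ Λ ^ (η / 4) := Real.one_le_rpow hΛ.le (by positivity)
  have hP₀le : P₀ ≤ Pc * Λ ^ (η / 4) := by
    have hPcΛ : Pc ≤ Pc * Λ ^ (η / 4) := le_mul_of_one_le_right hPc0.le hΛη
    have h3 : Λ ^ (3 : ℝ) = Λ ^ (3 : ℕ) := by exact_mod_cast Real.rpow_natCast Λ 3
    have hx : ((M : ℝ) + 2) * (T : ℝ) ^ 3 = G * Λ ^ (3 : ℝ) := by rw [hG, hT', h3]; ring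
    have hlog : Real.log (((M : ℝ) + 2) * (T : ℝ) ^ 3) ≤ (G ^ κ₂ / κ₂) * Λ ^ (η / 4) := by
      refine (Real.log_le_rpow_div (by positivity) hκ₂0).trans_eq ?_
      rw [hx, Real.mul_rpow hG0.le (by positivity), ← Real.rpow_mul hΛ0.le,
        show (3 : ℝ) * κ₂ = η / 4 by rw [hκ₂]; ring]
      ring
    rw [hP₀]
    refine max_le (le_trans (by linarith) hPcΛ) (max_le (le_trans (by linarith) hPcΛ) ?_)
    calc 2 * Real.log (((M : ℝ) + 2) * (T : ℝ) ^ 3) ≤ 2 * (G ^ κ₂ / κ₂) * Λ ^ (η / 4) := by linarith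
      _ ≤ Pc * Λ ^ (η / 4) := by
          refine mul_le_mul_of_nonneg_right ?_ (by positivity)
          rw [hPc]; linarith
  -- the determinant tool at every coordinate, for `P ≥ P₀`
  have hlogi : ∀ (i : Fin M) {P : ℝ}, P₀ ≤ P →
      2 * Real.log ((((i : ℕ) : ℝ) + 2) * (T : ℝ) ^ 3) ≤ P := by
    intro i P hP
    have hi : (((i : ℕ) : ℝ) + 2) * (T : ℝ) ^ 3 ≤ ((M : ℝ) + 2) * (T : ℝ) ^ 3 := by
      have : ((i : ℕ) : ℝ) ≤ M := by exact_mod_cast i.isLt.le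
      nlinarith [show (0 : ℝ) ≤ (T : ℝ) ^ 3 by positivity]
    have := Real.log_le_log (by positivity) hi
    linarith
  have hmul := shapeCount_le_of_certified hc₁ hc₂ hc₃ hXp hYp hZp (hTval hvX) (hTval hvY) (hTval hvZ)
    hD hΛ hBpos hC₀1 hΛdef hC₀le hP₀1
    (fun i hi P hP h48 => hdet hc₁ hc₂ hc₃ X Y Z hXp hYp hZp (hTval hvX) (hTval hvY) (hTval hvZ) hD
      i hi P (hN₀P₀.trans hP) (hlogi i hP) h48) hcert
  rw [← hV2, ← ha, ← hE] at hmul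
  -- `Dτ^a ≤ C_τ^a V₂^{η/4} Λ^{η/4}`
  have hD1 : 1 ≤ Dτ := by simpa using hD 1 one_ne_zero hT1
  have hDpos : (0 : ℝ) < Dτ := by exact_mod_cast hD1
  have hDa : (Dτ : ℝ) ^ a ≤ Cτ ^ a * (V2 : ℝ) ^ (η / 4) * Λ ^ (η / 4) := by
    calc (Dτ : ℝ) ^ a ≤ (Cτ * (T : ℝ) ^ κ) ^ a := Real.rpow_le_rpow (Nat.cast_nonneg _) hDreal ha0.le
      _ = Cτ ^ a * (T : ℝ) ^ (η / 4) := by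
          rw [Real.mul_rpow hCτ0.le (by positivity), ← Real.rpow_mul (Nat.cast_nonneg _), hκa]
      _ = Cτ ^ a * (V2 : ℝ) ^ (η / 4) * Λ ^ (η / 4) := by
          rw [hT', Real.mul_rpow hV2r.le hΛ0.le, mul_assoc]
  -- `Λ^θ Λ^{η/4} Λ^{η/4} = 2^{s-1+η} C₀^{s-1+η}`
  have hΛsplit : Λ ^ (s - 1 + η / 2) * Λ ^ (η / 4) * Λ ^ (η / 4) =
      (2 : ℝ) ^ (s - 1 + η) * (C₀ : ℝ) ^ (s - 1 + η) := by
    rw [← Real.rpow_add hΛ0, ← Real.rpow_add hΛ0, show s - 1 + η / 2 + η / 4 + η / 4 = s - 1 + η by ring,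
      hΛdef, Real.mul_rpow zero_le_two (by linarith)]
  have hθ0 : (0 : ℝ) ≤ Λ ^ (s - 1 + η / 2) := by positivity
  calc (shapeCount c₁ c₂ c₃ X Y Z : ℝ) ≤ Λ ^ (s - 1 + η / 2) * (Dτ : ℝ) ^ a * E * P₀ := hmul
    _ ≤ Λ ^ (s - 1 + η / 2) * (Cτ ^ a * (V2 : ℝ) ^ (η / 4) * Λ ^ (η / 4)) * E * (Pc * Λ ^ (η / 4)) :=
        mul_le_mul (mul_le_mul_of_nonneg_right (mul_le_mul_of_nonneg_left hDa hθ0) hE0.le) hP₀le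
          (by linarith) (by positivity)
    _ = Cτ ^ a * (V2 : ℝ) ^ (η / 4) * E * Pc * (Λ ^ (s - 1 + η / 2) * Λ ^ (η / 4) * Λ ^ (η / 4)) := by
        ring
    _ = K * (C₀ : ℝ) ^ (s - 1 + η) := by rw [hΛsplit, hK]; ring

end Summit.ABC.ABC.Theorems.MazurKaneLaw

end
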